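import Summits.QuantumFields.YangMills.Theorems.AllWindowsColdBoxBoxHighLineGaussianWeightTails

/-!
# Laplace SANDWICH for the orbit average `N_h` (T-S5.4 of `Cruxes/BoxWindowHighSU2213/STUB-PLAN-S5U5-STEP1b.md`) — part (4k-B):
# derivative-free second moments, determinant-ratio bounds by tangent-line Jensen, and the abstract two-sided sandwich

Serves the XL comparison stubs S5 (LINE-19, ⟨stmt-QuantumFields-24004⟩/⟨24335⟩) and U5 (LINE-20, ⟨24336⟩) of the
critic-PASSed DRAFT lines of planner ym-idea-2; seat ym-line-fcl-p3 g25.  Over part (4k-A) `…GaussianWeightTails` (½-convention: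
weight `e^{−½ vᵀPv}`, mass `Z(P) = √(2π)^{|ι|}/√det P`; instantiate with `P = 2β·FᵀF`).

* §1 ★ `integral_sq_coord_mul_le` (`∫ vᵢ² e^{−½vᵀPv} ≤ (P⁻¹)ᵢᵢ · Z(P)`, derivative-free from the one-coordinate exponential
  moment: `(t vᵢ)² ≤ e^{t vᵢ} + e^{−t vᵢ} − 2`, then `t ↓ 0`), `integral_dotProduct_self_mul_le` (`≤ tr P⁻¹ · Z(P)`);
  ★ `mass_add_smul_one_ge`: `Z(P + τ1) ≥ e^{−(τ/2) tr P⁻¹} · Z(P)` (tangent line of `e^{−(τ/2)y}` at `y = tr P⁻¹`, i.e. Jensen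
  without probability spaces) and ★ `mass_sub_smul_one_le`: `Z(P − τ1) ≤ e^{(τ/2) tr (P−τ1)⁻¹} · Z(P)`.
* §2 ★★ `laplace_sandwich_upper` / `laplace_sandwich_upper_shrink` / `laplace_sandwich_lower`: for `0 ≤ Ψ` dominated on the
  open sup-box `{∀ i, |vᵢ| < ρ}` by `e^{−½vᵀ(P−τ1)v}` and off it by `e^{−½vᵀP'v}` (resp. dominating `e^{−½vᵀ(P+τ1)v}` on the box),
  `∫Ψ ≤ e^{(τ/2)tr(P−τ1)⁻¹} Z(P) + 2(Σᵢ e^{−ρ²/(2(P'⁻¹)ᵢᵢ)}) Z(P')` (with `P' = (1−ε)P`: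
  `(e^{(τ/2)tr(P−τ1)⁻¹} + 2Σᵢ e^{−(1−ε)ρ²/(2(P⁻¹)ᵢᵢ)}/√(1−ε)^{|ι|}) Z(P)`) and
  `(e^{−(τ/2)tr P⁻¹} − 2Σᵢ e^{−ρ²/(2((P+τ1)⁻¹)ᵢᵢ)}) Z(P) ≤ ∫Ψ`.
USE (T-S5.4): `Ψ(A) = e^{−βΦ(A)}·χ(A)·(2π²)^{|I|}Πσ(|A_x|)` on `(I × Fin 3) → ℝ`, `P = 2β FᵀF`; bulk hypotheses from 4c/4e (cubic
remainder) + 4d (Haar flatness), shell hypothesis from the square structure `Φ = ‖FA + q(A)‖²` (see the seat's shell-budget memo);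
`(P⁻¹)ᵢᵢ` from 4i / the Hilbert–Schmidt row bound; `Z(P) = (π/β)^{n/2}/|det F|` = the planner's `Z₀·|det fpOperator|⁻¹`.

HONEST LABEL: abstract analytic frame for step (1b) of S5/U5; T-S5.4 proper, S5, U5 and the three items are OPEN; the
Yang–Mills mass gap is NOT proved by this file; no summit is proved by a line.
-/

set_option autoImplicit false

noncomputable section

open MeasureTheory Matrix Real

namespace Summit.QuantumFields.YangMills.Theorems.AllWindowsColdBoxBoxHighLine.LaplaceSandwich

open Literature.MathematicalPhysics.QuantumFieldTheory
open Literature.MathematicalPhysics.QuantumFieldTheory.Balaban1983to89.Beta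

variable {ι : Type*} [Fintype ι] [DecidableEq ι]

/-! ## §1 Second moments (derivative-free) and determinant-ratio bounds -/

/-- `x² ≤ e^x + e^{−x} − 2` (i.e. `1 + x²/2 ≤ cosh x`, from `cosh x = 1 + 2 sinh²(x/2)` and `y ≤ sinh y` for `y ≥ 0`). [folklore] -/
theorem sq_le_exp_add_exp_neg_sub_two (x : ℝ) : x ^ 2 ≤ Real.exp x + Real.exp (-x) - 2 := by
  have hc : x ^ 2 / 2 ≤ Real.cosh x - 1 := by
    wlog hx : 0 ≤ x generalizing x
    · have := this (-x) (by linarith)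
      rwa [neg_sq, Real.cosh_neg] at this
    have h := Real.cosh_two_mul (x / 2)
    rw [show 2 * (x / 2) = x by ring, Real.cosh_sq] at h
    have h1 : x / 2 ≤ Real.sinh (x / 2) := Real.self_le_sinh_iff.2 (by linarith)
    have h2 : 0 ≤ x / 2 := by linarith
    nlinarith [mul_le_mul h1 h1 h2 (h2.trans h1)]
  rw [Real.cosh_eq] at hc
  linarith

/-- Integrability of `vᵢ² e^{−½vᵀPv}` (dominated by `(e^{vᵢ} + e^{−vᵢ}) e^{−½vᵀPv}`). [folklore] -/
theorem integrable_sq_coord_mul_weight {P : Matrix ι ι ℝ} (hP : P.PosDef) (i : ι) :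
    Integrable (fun v : ι → ℝ => v i ^ 2 * Real.exp (-(1/2 : ℝ) * (v ⬝ᵥ P *ᵥ v))) := by
  have hdom := (integrable_exp_mul_coord_mul_weight hP i 1).add (integrable_exp_mul_coord_mul_weight hP i (-1))
  refine hdom.mono' (((continuous_apply i).pow 2).mul (continuous_weight P)).aestronglyMeasurable (ae_of_all _ fun v => ?_)
  have hf0 : 0 ≤ Real.exp (-(1/2 : ℝ) * (v ⬝ᵥ P *ᵥ v)) := (Real.exp_pos _).le
  rw [Real.norm_eq_abs, abs_of_nonneg (mul_nonneg (sq_nonneg _) hf0)]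
  simp only [one_mul, neg_one_mul, Pi.add_apply]
  have h := sq_le_exp_add_exp_neg_sub_two (v i)
  nlinarith [Real.exp_pos (v i), Real.exp_pos (-v i)]

/-- For `t > 0`: `t² ∫ vᵢ² e^{−½vᵀPv} ≤ 2 (e^{½t²(P⁻¹)ᵢᵢ} − 1) · √(2π)^{|ι|}/√det P` (integrate `(t vᵢ)² ≤ e^{t vᵢ} + e^{−t vᵢ} − 2`). [folklore] -/
theorem sq_mul_integral_sq_coord_mul_le {P : Matrix ι ι ℝ} (hP : P.PosDef) (i : ι) (t : ℝ) :
    t ^ 2 * ∫ v : ι → ℝ, v i ^ 2 * Real.exp (-(1/2 : ℝ) * (v ⬝ᵥ P *ᵥ v)) ≤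
      2 * (Real.exp ((1/2 : ℝ) * (t ^ 2 * P⁻¹ i i)) - 1) * (Real.sqrt (2 * Real.pi) ^ Fintype.card ι / Real.sqrt P.det) := by
  set f : (ι → ℝ) → ℝ := fun v => Real.exp (-(1/2 : ℝ) * (v ⬝ᵥ P *ᵥ v)) with hf_def
  have hf0 : ∀ v, 0 ≤ f v := fun v => (Real.exp_pos _).le
  have hfi : Integrable f := GaussianIntegral.integrable_exp_neg_half_quadForm P hP
  have hZ : ∫ v, f v = Real.sqrt (2 * Real.pi) ^ Fintype.card ι / Real.sqrt P.det :=
    GaussianIntegral.integral_exp_neg_half_quadForm P hP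
  have h1 := integrable_exp_mul_coord_mul_weight hP i t
  have h2 := integrable_exp_mul_coord_mul_weight hP i (-t)
  have h12 : Integrable (fun v : ι → ℝ => Real.exp (t * v i) * f v + Real.exp (-t * v i) * f v) := h1.add h2
  rw [← integral_const_mul]
  calc ∫ v : ι → ℝ, t ^ 2 * (v i ^ 2 * f v)
      ≤ ∫ v : ι → ℝ, (Real.exp (t * v i) * f v + Real.exp (-t * v i) * f v) - 2 * f v := by
        refine integral_mono_of_nonneg (ae_of_all _ fun v => by have := hf0 v; positivity) (h12.sub (hfi.const_mul 2))
          (ae_of_all _ fun v => ?_)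
        have h := sq_le_exp_add_exp_neg_sub_two (t * v i)
        rw [← neg_mul] at h
        have hsq : (t * v i) ^ 2 = t ^ 2 * v i ^ 2 := by ring
        have := hf0 v
        dsimp only
        nlinarith
    _ = 2 * (Real.exp ((1/2 : ℝ) * (t ^ 2 * P⁻¹ i i)) - 1) * (Real.sqrt (2 * Real.pi) ^ Fintype.card ι / Real.sqrt P.det) := by
        rw [integral_sub h12 (hfi.const_mul 2), integral_add h1 h2, integral_const_mul, hZ,
          integral_exp_mul_coord_mul_weight hP i t, integral_exp_mul_coord_mul_weight hP i (-t), neg_sq]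
        ring

/-- ★ **Coordinate second moment of the Gaussian weight (upper bound, derivative-free)**:
`∫ vᵢ² e^{−½vᵀPv} ≤ (P⁻¹)ᵢᵢ · √(2π)^{|ι|}/√det P` (let `t ↓ 0` in `sq_mul_integral_sq_coord_mul_le`). [folklore] -/
theorem integral_sq_coord_mul_le {P : Matrix ι ι ℝ} (hP : P.PosDef) (i : ι) :
    ∫ v : ι → ℝ, v i ^ 2 * Real.exp (-(1/2 : ℝ) * (v ⬝ᵥ P *ᵥ v)) ≤
      P⁻¹ i i * (Real.sqrt (2 * Real.pi) ^ Fintype.card ι / Real.sqrt P.det) := by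
  set σ : ℝ := P⁻¹ i i with hσ_def
  set Z : ℝ := Real.sqrt (2 * Real.pi) ^ Fintype.card ι / Real.sqrt P.det with hZ_def
  set I : ℝ := ∫ v : ι → ℝ, v i ^ 2 * Real.exp (-(1/2 : ℝ) * (v ⬝ᵥ P *ᵥ v)) with hI_def
  have hσ : 0 < σ := hP.inv.diag_pos
  have hZ : 0 < Z := mass_pos hP
  refine le_of_forall_pos_le_add fun ε hε => ?_
  -- choose `t² = a := min (1/σ) (ε/(Z σ²))`
  set a : ℝ := min (1 / σ) (ε / (Z * σ ^ 2)) with ha_def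
  have ha : 0 < a := lt_min (by positivity) (by positivity)
  have ha1 : a ≤ 1 / σ := min_le_left _ _
  have ha2 : a ≤ ε / (Z * σ ^ 2) := min_le_right _ _
  set t : ℝ := Real.sqrt a with ht_def
  have ht2 : t ^ 2 = a := Real.sq_sqrt ha.le
  have hmain := sq_mul_integral_sq_coord_mul_le hP i t
  rw [ht2] at hmain
  -- `e^s − 1 ≤ s + s²` for `s = ½ a σ ≤ ½`
  set s : ℝ := (1/2 : ℝ) * (a * σ) with hs_def
  have hs0 : 0 ≤ s := by positivity
  have hs1 : s ≤ 1 / 2 := by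
    rw [hs_def]
    have : a * σ ≤ 1 := by
      have := mul_le_mul_of_nonneg_right ha1 hσ.le
      rwa [one_div, inv_mul_cancel₀ hσ.ne'] at this
    linarith
  have hexp : Real.exp s - 1 ≤ s + s ^ 2 := by
    have := Real.abs_exp_sub_one_sub_id_le (x := s) (by rw [abs_of_nonneg hs0]; linarith)
    have := (abs_le.1 this).2
    linarith
  -- `a · I ≤ 2 (s + s²) Z = a σ (1 + s) Z`, so `I ≤ σ Z (1 + s) ≤ σ Z + ε`
  have hI : a * I ≤ a * (σ * Z * (1 + s)) := by
    calc a * I ≤ 2 * (Real.exp s - 1) * Z := hmain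
      _ ≤ 2 * (s + s ^ 2) * Z := by gcongr
      _ = a * (σ * Z * (1 + s)) := by rw [hs_def]; ring
  have hI' : I ≤ σ * Z * (1 + s) := le_of_mul_le_mul_left hI ha
  have hsmall : σ * Z * s ≤ ε := by
    rw [hs_def]
    have : a * (Z * σ ^ 2) ≤ ε := by
      have := mul_le_mul_of_nonneg_right ha2 (by positivity : 0 ≤ Z * σ ^ 2)
      rwa [div_mul_cancel₀ _ (by positivity : Z * σ ^ 2 ≠ 0)] at this
    nlinarith
  calc I ≤ σ * Z * (1 + s) := hI'
    _ = σ * Z + σ * Z * s := by ring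
    _ ≤ σ * Z + ε := by linarith

/-- Integrability of `|v|² e^{−½vᵀPv}`. [folklore] -/
theorem integrable_dotProduct_self_mul_weight {P : Matrix ι ι ℝ} (hP : P.PosDef) :
    Integrable (fun v : ι → ℝ => (v ⬝ᵥ v) * Real.exp (-(1/2 : ℝ) * (v ⬝ᵥ P *ᵥ v))) := by
  have := integrable_finsetSum Finset.univ fun i _ => integrable_sq_coord_mul_weight hP i
  refine this.congr (ae_of_all _ fun v => ?_)
  simp only [dotProduct, ← Finset.sum_mul, sq]

/-- ★ **Second moment of the Gaussian weight (upper bound)**: `∫ |v|² e^{−½vᵀPv} ≤ tr(P⁻¹) · √(2π)^{|ι|}/√det P`. [folklore] -/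
theorem integral_dotProduct_self_mul_le {P : Matrix ι ι ℝ} (hP : P.PosDef) :
    ∫ v : ι → ℝ, (v ⬝ᵥ v) * Real.exp (-(1/2 : ℝ) * (v ⬝ᵥ P *ᵥ v)) ≤
      P⁻¹.trace * (Real.sqrt (2 * Real.pi) ^ Fintype.card ι / Real.sqrt P.det) := by
  have heq : ∫ v : ι → ℝ, (v ⬝ᵥ v) * Real.exp (-(1/2 : ℝ) * (v ⬝ᵥ P *ᵥ v)) =
      ∑ i, ∫ v : ι → ℝ, v i ^ 2 * Real.exp (-(1/2 : ℝ) * (v ⬝ᵥ P *ᵥ v)) := by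
    rw [← integral_finsetSum Finset.univ fun i _ => integrable_sq_coord_mul_weight hP i]
    refine integral_congr_ae (ae_of_all _ fun v => ?_)
    simp only [dotProduct, ← Finset.sum_mul, sq]
  rw [heq, Matrix.trace, Finset.sum_mul]
  exact Finset.sum_le_sum fun i _ => integral_sq_coord_mul_le hP i

/-- ★ **Lower determinant-ratio bound (tangent-line Jensen)**: for `P` positive definite and `τ ≥ 0`,
`e^{−(τ/2)·tr P⁻¹} · ∫ e^{−½vᵀPv} ≤ ∫ e^{−½vᵀ(P+τ1)v}`, i.e. `√det P/√det(P + τ1) ≥ e^{−(τ/2) tr P⁻¹}`: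
shifting the precision by `τ` costs at most the factor `e^{(τ/2)·E|v|²}`. [folklore] -/
theorem integral_weight_add_smul_one_ge {P : Matrix ι ι ℝ} (hP : P.PosDef) {τ : ℝ} (hτ : 0 ≤ τ) :
    Real.exp (-(τ / 2 * P⁻¹.trace)) * (Real.sqrt (2 * Real.pi) ^ Fintype.card ι / Real.sqrt P.det) ≤
      ∫ v : ι → ℝ, Real.exp (-(1/2 : ℝ) * (v ⬝ᵥ (P + τ • (1 : Matrix ι ι ℝ)) *ᵥ v)) := by
  set f : (ι → ℝ) → ℝ := fun v => Real.exp (-(1/2 : ℝ) * (v ⬝ᵥ P *ᵥ v)) with hf_def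
  set m : ℝ := P⁻¹.trace with hm_def
  set Z : ℝ := Real.sqrt (2 * Real.pi) ^ Fintype.card ι / Real.sqrt P.det with hZ_def
  have hf0 : ∀ v, 0 ≤ f v := fun v => (Real.exp_pos _).le
  have hfi : Integrable f := GaussianIntegral.integrable_exp_neg_half_quadForm P hP
  have hZ : ∫ v, f v = Z := GaussianIntegral.integral_exp_neg_half_quadForm P hP
  have h2 := integral_dotProduct_self_mul_le hP
  have hqi := integrable_dotProduct_self_mul_weight hP
  -- pointwise tangent line of `y ↦ e^{−(τ/2) y}` at `y = m`
  have hpt : ∀ v : ι → ℝ, Real.exp (-(τ / 2 * m)) * ((1 + τ / 2 * m) * f v - τ / 2 * ((v ⬝ᵥ v) * f v)) ≤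
      Real.exp (-(1/2 : ℝ) * (v ⬝ᵥ (P + τ • (1 : Matrix ι ι ℝ)) *ᵥ v)) := by
    intro v
    rw [dotProduct_add_smul_one_mulVec, mul_add, Real.exp_add]
    have hkey : Real.exp (-(τ / 2 * m)) * (1 + τ / 2 * m - τ / 2 * (v ⬝ᵥ v)) ≤ Real.exp (-(1/2 : ℝ) * (τ * (v ⬝ᵥ v))) := by
      have h1 : 1 + τ / 2 * m - τ / 2 * (v ⬝ᵥ v) ≤ Real.exp (τ / 2 * m - τ / 2 * (v ⬝ᵥ v)) := by
        have := Real.add_one_le_exp (τ / 2 * m - τ / 2 * (v ⬝ᵥ v)); linarith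
      calc Real.exp (-(τ / 2 * m)) * (1 + τ / 2 * m - τ / 2 * (v ⬝ᵥ v))
          ≤ Real.exp (-(τ / 2 * m)) * Real.exp (τ / 2 * m - τ / 2 * (v ⬝ᵥ v)) :=
            mul_le_mul_of_nonneg_left h1 (Real.exp_pos _).le
        _ = Real.exp (-(1/2 : ℝ) * (τ * (v ⬝ᵥ v))) := by rw [← Real.exp_add]; congr 1; ring
    have := mul_le_mul_of_nonneg_left hkey (hf0 v)
    calc Real.exp (-(τ / 2 * m)) * ((1 + τ / 2 * m) * f v - τ / 2 * ((v ⬝ᵥ v) * f v))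
        = f v * (Real.exp (-(τ / 2 * m)) * (1 + τ / 2 * m - τ / 2 * (v ⬝ᵥ v))) := by ring
      _ ≤ f v * Real.exp (-(1/2 : ℝ) * (τ * (v ⬝ᵥ v))) := this
      _ = Real.exp (-(1/2 : ℝ) * (v ⬝ᵥ P *ᵥ v)) * Real.exp (-(1/2 : ℝ) * (τ * (v ⬝ᵥ v))) := rfl
  have hli : Integrable fun v : ι → ℝ => Real.exp (-(τ / 2 * m)) * ((1 + τ / 2 * m) * f v - τ / 2 * ((v ⬝ᵥ v) * f v)) :=
    ((hfi.const_mul _).sub (hqi.const_mul _)).const_mul _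
  have hri : Integrable fun v : ι → ℝ => Real.exp (-(1/2 : ℝ) * (v ⬝ᵥ (P + τ • (1 : Matrix ι ι ℝ)) *ᵥ v)) :=
    GaussianIntegral.integrable_exp_neg_half_quadForm _ (posDef_add_smul_one hP hτ)
  calc Real.exp (-(τ / 2 * m)) * Z
      ≤ Real.exp (-(τ / 2 * m)) * ((1 + τ / 2 * m) * Z - τ / 2 * (m * Z)) := by
        have hτm : 0 ≤ τ / 2 := by linarith
        have : τ / 2 * ∫ v : ι → ℝ, (v ⬝ᵥ v) * f v ≤ τ / 2 * (m * Z) := mul_le_mul_of_nonneg_left h2 hτm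
        have hle : Real.exp (-(τ / 2 * m)) * Z ≤ Real.exp (-(τ / 2 * m)) * ((1 + τ / 2 * m) * Z - τ / 2 * (m * Z)) := by
          apply le_of_eq; ring
        exact hle
    _ ≤ Real.exp (-(τ / 2 * m)) * ((1 + τ / 2 * m) * Z - τ / 2 * ∫ v : ι → ℝ, (v ⬝ᵥ v) * f v) := by
        have hτm : 0 ≤ τ / 2 := by linarith
        have : τ / 2 * ∫ v : ι → ℝ, (v ⬝ᵥ v) * f v ≤ τ / 2 * (m * Z) := mul_le_mul_of_nonneg_left h2 hτm
        exact mul_le_mul_of_nonneg_left (by linarith) (Real.exp_pos _).le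
    _ = ∫ v : ι → ℝ, Real.exp (-(τ / 2 * m)) * ((1 + τ / 2 * m) * f v - τ / 2 * ((v ⬝ᵥ v) * f v)) := by
        rw [integral_const_mul, integral_sub (hfi.const_mul _) (hqi.const_mul _), integral_const_mul, integral_const_mul, hZ]
    _ ≤ ∫ v : ι → ℝ, Real.exp (-(1/2 : ℝ) * (v ⬝ᵥ (P + τ • (1 : Matrix ι ι ℝ)) *ᵥ v)) := integral_mono hli hri hpt

/-- ★ The same as a pure DETERMINANT inequality: `e^{−(τ/2) tr P⁻¹}/√det P ≤ 1/√det(P + τ1)`, packaged with the masses. [folklore] -/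
theorem mass_add_smul_one_ge {P : Matrix ι ι ℝ} (hP : P.PosDef) {τ : ℝ} (hτ : 0 ≤ τ) :
    Real.exp (-(τ / 2 * P⁻¹.trace)) * (Real.sqrt (2 * Real.pi) ^ Fintype.card ι / Real.sqrt P.det) ≤
      Real.sqrt (2 * Real.pi) ^ Fintype.card ι / Real.sqrt (P + τ • (1 : Matrix ι ι ℝ)).det := by
  rw [← GaussianIntegral.integral_exp_neg_half_quadForm _ (posDef_add_smul_one hP hτ)]
  exact integral_weight_add_smul_one_ge hP hτ

/-- ★ **Upper determinant-ratio bound**: if `P − τ1` is positive definite (`τ ≥ 0`) then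
`∫ e^{−½vᵀ(P−τ1)v} ≤ e^{(τ/2)·tr (P−τ1)⁻¹} · ∫ e^{−½vᵀPv}`, i.e. `√det P/√det(P − τ1) ≤ e^{(τ/2) tr (P − τ1)⁻¹}`
(the lower bound applied to `P − τ1`). [folklore] -/
theorem mass_sub_smul_one_le {P : Matrix ι ι ℝ} {τ : ℝ} (hPτ : (P - τ • (1 : Matrix ι ι ℝ)).PosDef) (hτ : 0 ≤ τ) :
    Real.sqrt (2 * Real.pi) ^ Fintype.card ι / Real.sqrt (P - τ • (1 : Matrix ι ι ℝ)).det ≤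
      Real.exp (τ / 2 * (P - τ • (1 : Matrix ι ι ℝ))⁻¹.trace) * (Real.sqrt (2 * Real.pi) ^ Fintype.card ι / Real.sqrt P.det) := by
  have h := mass_add_smul_one_ge hPτ hτ
  rw [sub_add_cancel] at h
  set c : ℝ := τ / 2 * (P - τ • (1 : Matrix ι ι ℝ))⁻¹.trace with hc
  calc Real.sqrt (2 * Real.pi) ^ Fintype.card ι / Real.sqrt (P - τ • (1 : Matrix ι ι ℝ)).det
      = Real.exp c * (Real.exp (-c) * (Real.sqrt (2 * Real.pi) ^ Fintype.card ι / Real.sqrt (P - τ • (1 : Matrix ι ι ℝ)).det)) := by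
        rw [← mul_assoc, ← Real.exp_add, add_neg_cancel, Real.exp_zero, one_mul]
    _ ≤ Real.exp c * (Real.sqrt (2 * Real.pi) ^ Fintype.card ι / Real.sqrt P.det) :=
        mul_le_mul_of_nonneg_left h (Real.exp_pos _).le

/-! ## §2 The two-sided Laplace sandwich -/

omit [Fintype ι] [DecidableEq ι] in
/-- The complement of the open sup-box `{∀ i, |vᵢ| < ρ}` is the union tail set. [folklore] -/
theorem not_forall_abs_lt_iff (v : ι → ℝ) (ρ : ℝ) : (¬ ∀ i, |v i| < ρ) ↔ ∃ i, ρ ≤ |v i| := by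
  simp [not_lt]

/-- Shifting the precision up decreases the mass: `∫ e^{−½vᵀ(P+τ1)v} ≤ ∫ e^{−½vᵀPv}` for `τ ≥ 0`. [folklore] -/
theorem integral_weight_add_smul_one_le {P : Matrix ι ι ℝ} (hP : P.PosDef) {τ : ℝ} (hτ : 0 ≤ τ) :
    ∫ v : ι → ℝ, Real.exp (-(1/2 : ℝ) * (v ⬝ᵥ (P + τ • (1 : Matrix ι ι ℝ)) *ᵥ v)) ≤
      Real.sqrt (2 * Real.pi) ^ Fintype.card ι / Real.sqrt P.det := by
  rw [← GaussianIntegral.integral_exp_neg_half_quadForm P hP]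
  refine integral_mono (GaussianIntegral.integrable_exp_neg_half_quadForm _ (posDef_add_smul_one hP hτ))
    (GaussianIntegral.integrable_exp_neg_half_quadForm P hP) fun v => ?_
  dsimp only
  rw [dotProduct_add_smul_one_mulVec]
  refine Real.exp_le_exp.2 ?_
  have : 0 ≤ τ * (v ⬝ᵥ v) := mul_nonneg hτ (by
    have : v ⬝ᵥ v = ∑ i, v i ^ 2 := by simp [dotProduct, sq]
    rw [this]; positivity)
  nlinarith

/-- ★★ **LAPLACE SANDWICH, UPPER (raw form)**: let `P`, `P − τ1` (`τ ≥ 0`) and `P'` be positive definite, `ρ ≥ 0`, and `0 ≤ Ψ`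
with `Ψ ≤ e^{−½vᵀ(P−τ1)v}` on the open sup-box `{∀ i, |vᵢ| < ρ}` and `Ψ ≤ e^{−½vᵀP'v}` off it.  Then
`∫Ψ ≤ e^{(τ/2) tr (P−τ1)⁻¹} · Z(P) + 2 (Σᵢ e^{−ρ²/(2 (P'⁻¹)ᵢᵢ)}) · Z(P')`, `Z(Q) = √(2π)^{|ι|}/√det Q`
(bulk by the determinant-ratio bound, shell by the relative coordinate tails).  No measurability of `Ψ` is needed. [folklore] -/
theorem laplace_sandwich_upper {P P' : Matrix ι ι ℝ} (hP' : P'.PosDef) {τ ρ : ℝ} (hτ : 0 ≤ τ)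
    (hPτ : (P - τ • (1 : Matrix ι ι ℝ)).PosDef) (hρ : 0 ≤ ρ) {Ψ : (ι → ℝ) → ℝ} (hΨ0 : ∀ v, 0 ≤ Ψ v)
    (hbulk : ∀ v : ι → ℝ, (∀ i, |v i| < ρ) → Ψ v ≤ Real.exp (-(1/2 : ℝ) * (v ⬝ᵥ (P - τ • (1 : Matrix ι ι ℝ)) *ᵥ v)))
    (hshell : ∀ v : ι → ℝ, (∃ i, ρ ≤ |v i|) → Ψ v ≤ Real.exp (-(1/2 : ℝ) * (v ⬝ᵥ P' *ᵥ v))) :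
    ∫ v, Ψ v ≤
      Real.exp (τ / 2 * (P - τ • (1 : Matrix ι ι ℝ))⁻¹.trace) * (Real.sqrt (2 * Real.pi) ^ Fintype.card ι / Real.sqrt P.det) +
        2 * (∑ i, Real.exp (-(ρ ^ 2 / (2 * P'⁻¹ i i)))) * (Real.sqrt (2 * Real.pi) ^ Fintype.card ι / Real.sqrt P'.det) := by
  set S : Set (ι → ℝ) := {v | ∃ i, ρ ≤ |v i|} with hS
  set fτ : (ι → ℝ) → ℝ := fun v => Real.exp (-(1/2 : ℝ) * (v ⬝ᵥ (P - τ • (1 : Matrix ι ι ℝ)) *ᵥ v)) with hfτ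
  set f' : (ι → ℝ) → ℝ := fun v => Real.exp (-(1/2 : ℝ) * (v ⬝ᵥ P' *ᵥ v)) with hf'
  have hfτi : Integrable fτ := GaussianIntegral.integrable_exp_neg_half_quadForm _ hPτ
  have hf'i : Integrable f' := GaussianIntegral.integrable_exp_neg_half_quadForm _ hP'
  have hdom : ∀ v, Ψ v ≤ fτ v + S.indicator f' v := by
    intro v
    by_cases hv : ∀ i, |v i| < ρ
    · have h1 := hbulk v hv
      have h2 : 0 ≤ S.indicator f' v := Set.indicator_nonneg (fun w _ => (Real.exp_pos _).le) v
      linarith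
    · have hv' : v ∈ S := (not_forall_abs_lt_iff v ρ).1 hv
      rw [Set.indicator_of_mem hv']
      have h1 := hshell v hv'
      have h2 : 0 ≤ fτ v := (Real.exp_pos _).le
      linarith
  calc ∫ v, Ψ v ≤ ∫ v, (fτ v + S.indicator f' v) :=
        integral_mono_of_nonneg (ae_of_all _ hΨ0) (hfτi.add (hf'i.indicator (measurableSet_exists_coord_tail ρ)))
          (ae_of_all _ hdom)
    _ = (∫ v, fτ v) + ∫ v in S, f' v := by
        rw [integral_add hfτi (hf'i.indicator (measurableSet_exists_coord_tail ρ)), integral_indicator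
          (measurableSet_exists_coord_tail ρ)]
    _ ≤ _ := by
        have h1 : ∫ v, fτ v ≤ Real.exp (τ / 2 * (P - τ • (1 : Matrix ι ι ℝ))⁻¹.trace) *
            (Real.sqrt (2 * Real.pi) ^ Fintype.card ι / Real.sqrt P.det) := by
          rw [hfτ, GaussianIntegral.integral_exp_neg_half_quadForm _ hPτ]
          exact mass_sub_smul_one_le hPτ hτ
        have h2 := setIntegral_exists_coord_tail_le hP' hρ
        exact add_le_add h1 h2

/-- ★★ **LAPLACE SANDWICH, LOWER (raw form)**: let `P` be positive definite, `τ, ρ ≥ 0`, `0 ≤ Ψ` integrable with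
`Ψ ≥ e^{−½vᵀ(P+τ1)v}` on the open sup-box `{∀ i, |vᵢ| < ρ}`.  Then
`(e^{−(τ/2) tr P⁻¹} − 2 Σᵢ e^{−ρ²/(2 ((P+τ1)⁻¹)ᵢᵢ)}) · Z(P) ≤ ∫Ψ`. [folklore] -/
theorem laplace_sandwich_lower {P : Matrix ι ι ℝ} (hP : P.PosDef) {τ ρ : ℝ} (hτ : 0 ≤ τ) (hρ : 0 ≤ ρ)
    {Ψ : (ι → ℝ) → ℝ} (hΨ0 : ∀ v, 0 ≤ Ψ v) (hΨi : Integrable Ψ)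
    (hbulk : ∀ v : ι → ℝ, (∀ i, |v i| < ρ) → Real.exp (-(1/2 : ℝ) * (v ⬝ᵥ (P + τ • (1 : Matrix ι ι ℝ)) *ᵥ v)) ≤ Ψ v) :
    (Real.exp (-(τ / 2 * P⁻¹.trace)) - 2 * ∑ i, Real.exp (-(ρ ^ 2 / (2 * (P + τ • (1 : Matrix ι ι ℝ))⁻¹ i i)))) *
        (Real.sqrt (2 * Real.pi) ^ Fintype.card ι / Real.sqrt P.det) ≤ ∫ v, Ψ v := by
  set S : Set (ι → ℝ) := {v | ∃ i, ρ ≤ |v i|} with hS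
  set Pτ : Matrix ι ι ℝ := P + τ • (1 : Matrix ι ι ℝ) with hPτ_def
  have hPτ : Pτ.PosDef := posDef_add_smul_one hP hτ
  set fτ : (ι → ℝ) → ℝ := fun v => Real.exp (-(1/2 : ℝ) * (v ⬝ᵥ Pτ *ᵥ v)) with hfτ
  have hfτi : Integrable fτ := GaussianIntegral.integrable_exp_neg_half_quadForm _ hPτ
  have hdom : ∀ v, fτ v - S.indicator fτ v ≤ Ψ v := by
    intro v
    by_cases hv : ∀ i, |v i| < ρ
    · have hv' : v ∉ S := fun h => (not_forall_abs_lt_iff v ρ).2 h hv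
      rw [Set.indicator_of_notMem hv', sub_zero]
      exact hbulk v hv
    · have hv' : v ∈ S := (not_forall_abs_lt_iff v ρ).1 hv
      rw [Set.indicator_of_mem hv', sub_self]
      exact hΨ0 v
  have hZτ : ∫ v, fτ v = Real.sqrt (2 * Real.pi) ^ Fintype.card ι / Real.sqrt Pτ.det :=
    GaussianIntegral.integral_exp_neg_half_quadForm _ hPτ
  have hlow : Real.exp (-(τ / 2 * P⁻¹.trace)) * (Real.sqrt (2 * Real.pi) ^ Fintype.card ι / Real.sqrt P.det) ≤ ∫ v, fτ v :=
    integral_weight_add_smul_one_ge hP hτ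
  have hZle : Real.sqrt (2 * Real.pi) ^ Fintype.card ι / Real.sqrt Pτ.det ≤
      Real.sqrt (2 * Real.pi) ^ Fintype.card ι / Real.sqrt P.det := by
    rw [← hZτ]; exact integral_weight_add_smul_one_le hP hτ
  have htail : ∫ v in S, fτ v ≤ 2 * (∑ i, Real.exp (-(ρ ^ 2 / (2 * Pτ⁻¹ i i)))) *
      (Real.sqrt (2 * Real.pi) ^ Fintype.card ι / Real.sqrt P.det) :=
    (setIntegral_exists_coord_tail_le hPτ hρ).trans (mul_le_mul_of_nonneg_left hZle (by positivity))
  calc (Real.exp (-(τ / 2 * P⁻¹.trace)) - 2 * ∑ i, Real.exp (-(ρ ^ 2 / (2 * Pτ⁻¹ i i)))) *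
        (Real.sqrt (2 * Real.pi) ^ Fintype.card ι / Real.sqrt P.det)
      = Real.exp (-(τ / 2 * P⁻¹.trace)) * (Real.sqrt (2 * Real.pi) ^ Fintype.card ι / Real.sqrt P.det) -
          2 * (∑ i, Real.exp (-(ρ ^ 2 / (2 * Pτ⁻¹ i i)))) * (Real.sqrt (2 * Real.pi) ^ Fintype.card ι / Real.sqrt P.det) := by
        ring
    _ ≤ (∫ v, fτ v) - ∫ v in S, fτ v := sub_le_sub hlow htail
    _ = ∫ v, (fτ v - S.indicator fτ v) := by
        rw [integral_sub hfτi (hfτi.indicator (measurableSet_exists_coord_tail ρ)), integral_indicator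
          (measurableSet_exists_coord_tail ρ)]
    _ ≤ ∫ v, Ψ v := integral_mono (hfτi.sub (hfτi.indicator (measurableSet_exists_coord_tail ρ))) hΨi hdom

/-- ★★ **LAPLACE SANDWICH, UPPER, shell Gaussian `(1−ε)·P`**: with the shell domination `Ψ ≤ e^{−½(1−ε)vᵀPv}` (`ε < 1`)
the bound reads `∫Ψ ≤ (e^{(τ/2) tr (P−τ1)⁻¹} + 2 (Σᵢ e^{−(1−ε)ρ²/(2 (P⁻¹)ᵢᵢ)}) / √(1−ε)^{|ι|}) · Z(P)`. [folklore] -/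
theorem laplace_sandwich_upper_shrink {P : Matrix ι ι ℝ} (hP : P.PosDef) {τ ρ ε : ℝ} (hτ : 0 ≤ τ)
    (hPτ : (P - τ • (1 : Matrix ι ι ℝ)).PosDef) (hρ : 0 ≤ ρ) (hε1 : ε < 1)
    {Ψ : (ι → ℝ) → ℝ} (hΨ0 : ∀ v, 0 ≤ Ψ v)
    (hbulk : ∀ v : ι → ℝ, (∀ i, |v i| < ρ) → Ψ v ≤ Real.exp (-(1/2 : ℝ) * (v ⬝ᵥ (P - τ • (1 : Matrix ι ι ℝ)) *ᵥ v)))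
    (hshell : ∀ v : ι → ℝ, (∃ i, ρ ≤ |v i|) → Ψ v ≤ Real.exp (-(1/2 : ℝ) * ((1 - ε) * (v ⬝ᵥ P *ᵥ v)))) :
    ∫ v, Ψ v ≤
      (Real.exp (τ / 2 * (P - τ • (1 : Matrix ι ι ℝ))⁻¹.trace) +
        2 * (∑ i, Real.exp (-((1 - ε) * ρ ^ 2 / (2 * P⁻¹ i i)))) / Real.sqrt (1 - ε) ^ Fintype.card ι) *
        (Real.sqrt (2 * Real.pi) ^ Fintype.card ι / Real.sqrt P.det) := by
  have hc : 0 < 1 - ε := by linarith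
  have hP' : ((1 - ε) • P).PosDef := hP.smul hc
  have hshell' : ∀ v : ι → ℝ, (∃ i, ρ ≤ |v i|) → Ψ v ≤ Real.exp (-(1/2 : ℝ) * (v ⬝ᵥ ((1 - ε) • P) *ᵥ v)) := by
    intro v hv
    have := hshell v hv
    rwa [Matrix.smul_mulVec, dotProduct_smul, smul_eq_mul]
  have h := laplace_sandwich_upper hP' hτ hPτ hρ hΨ0 hbulk hshell'
  rw [mass_smul P hc, inv_smul_of_posDef hP hc.ne'] at h
  have hdiag : ∀ i, Real.exp (-(ρ ^ 2 / (2 * ((1 - ε)⁻¹ • P⁻¹) i i))) = Real.exp (-((1 - ε) * ρ ^ 2 / (2 * P⁻¹ i i))) := by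
    intro i
    have hσ : 0 < P⁻¹ i i := hP.inv.diag_pos
    rw [Matrix.smul_apply, smul_eq_mul]
    congr 2
    field_simp
  simp_rw [hdiag] at h
  calc ∫ v, Ψ v ≤ _ := h
    _ = _ := by ring


end Summit.QuantumFields.YangMills.Theorems.AllWindowsColdBoxBoxHighLine.LaplaceSandwich

end
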